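import Mathlib
import Literature.NumberTheory.LFunctions.Zhang2022.SkeletonEvalRelE
import Literature.NumberTheory.LFunctions.Zhang2022.Section18Margin232D
import HarnessLib

/-!
# Zhang (2022), typed skeleton — RT-05 record: the §18 margin FAILS at the derived `e″_{1j}` too

Topic `Literature/NumberTheory/LFunctions/Zhang2022` (Landau–Siegel audit tree; verdict-neutral).
Y. Zhang, *Discrete mean estimates and the Landau–Siegel zero*, arXiv:2211.02515v1 (2022)
[Zhang2022LandauSiegel] — **an unrefereed manuscript under adjudication.**

For the record of the ZHANG-L lane's re-type RT-05 (zl-lead R-22/R-28; referee condition C3): the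
parametrised margin `Skeleton.Margin232WithE e1pp k` (`SkeletonEvalRelE`) instantiated at the DERIVED value
`e1ppD` of `e″_{1j}` (the last display of the proof of (B.3); reading of record D-G-num2-1) is the negated
statement of zl-w15-ref-1's certified `not_margin232D_with_of_le` (`Section18Margin232D`, p475116:
`0.05 < 𝔠₁ + 𝔠₂ᶜ + 2(Re 𝔠₃ᴰ − 10⁻⁵)`), via the `rfl` bridge `frakc3D_eq_frakc3E_e1ppD` (`Section18DefsE`).
So the ONE permitted hypothesis of the lane's terminal `theorem1_of_sec18`, in the RT-05 reading
`Margin232WithE e1ppD frakc2c.re`, is refuted in the kernel exactly as the printed-value one was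
(`not_margin232c`): the terminal theorem stays DOCUMENTARY; the non-vacuous content is the margin-free
companion `sec2_inputs_hold`. These theorems are NEVER used by a skeleton chain (honesty clause R-07:
the chain consumes the margin positively); `#cone_check` of every `theorem1_of_leaves_vN` lists them as
forbidden constants.

## References

* Y. Zhang, arXiv:2211.02515v1 (2022), §18 p. 99–100 ("𝔠₁ + 𝔠₂ + 2Re 𝔠₃ < 0.001"), Appendix B (B.3).
  [cite: Zhang2022LandauSiegel, §18 p. 100]
-/

noncomputable section

namespace Literature.NumberTheory.LFunctions.Zhang2022.Skeleton

/-- **At the DERIVED `e″_{1j}` the §18 margin fails for every `𝔠₂`-reading `k ≥ Re 𝔠₂ᶜ`** (from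
`not_margin232D_with_of_le`, certified total `> 0.05`). NOT used by any chain theorem.
[cite: Zhang2022LandauSiegel, §18 p. 100] -/
theorem not_margin232WithE_e1ppD_of_le {k : ℝ} (hk : frakc2c.re ≤ k) : ¬ Margin232WithE e1ppD k := by
  rw [Margin232WithE, ← frakc3D_eq_frakc3E_e1ppD]
  exact not_margin232D_with_of_le hk

/-- The c-reading instance (the terminal hypothesis-to-be of RT-05): `¬ Margin232WithE e1ppD (Re 𝔠₂ᶜ)`.
[cite: Zhang2022LandauSiegel, §18 p. 100] -/
theorem not_margin232WithE_e1ppD_frakc2c : ¬ Margin232WithE e1ppD frakc2c.re :=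
  not_margin232WithE_e1ppD_of_le le_rfl

/-- The printed-prefactor reading `k = Re 𝔠₂` fails as well (`frakc2c.re ≤ frakc2.re`).
[cite: Zhang2022LandauSiegel, §18 p. 100] -/
theorem not_margin232WithE_e1ppD_frakc2 : ¬ Margin232WithE e1ppD frakc2.re :=
  not_margin232WithE_e1ppD_of_le frakc2c_re_le_frakc2_re

end Literature.NumberTheory.LFunctions.Zhang2022.Skeleton
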